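import Literature.NumberTheory.EllipticCurves.HasseWeilAbelianEulerFactorKodairaNeronProofs
import Literature.NumberTheory.EllipticCurves.KodairaNeronMultiplicativeProofs
import Literature.NumberTheory.EllipticCurves.InertiaInvariantsMultiplicativeProofs
import HarnessLib

/-!
# The Frobenius action on `(V_ℓ E)^{I_𝔓}` at the non-split multiplicative places: discharge of
# `frobenius_smul_fixedSubmodule_inertia_rationalTate_of_hasNonsplitMultiplicativeReductionAt`

Proof file (theorems only, no definitions, no named facts) in topic `NumberTheory/EllipticCurves`,
sibling of `HasseWeilAbelianEulerFactorElliptic`, discharging its named fact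
`WeierstrassCurve.frobenius_smul_fixedSubmodule_inertia_rationalTate_of_hasNonsplitMultiplicativeReductionAt W ℓ`:
*for an elliptic curve `E/K` over a number field with non-split multiplicative reduction at the
finite place `v ∤ ℓ`, a prime `𝔓 ∣ v` of `\bar ℤ_K` and an arithmetic Frobenius `σ ∈ Γ_K` at `𝔓`,
`σ` acts on the inertia invariants `(V_ℓ E)^{I_𝔓}` as multiplication by `-N v`* (Silverman,
*ATAEC*, Thm. V.5.3 with Lemma V.5.2(c), Exercises 5.11(b), 5.13: `V_ℓ(E) ≅ V_ℓ(E_q) ⊗ χ`, `χ`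
the unramified quadratic character; Serre–Tate §1 Lemma 2 with the non-split torus), and with it
the non-split bad-place fact
`WeierstrassCurve.inertiaCoinvariants_rationalTate_of_hasNonsplitMultiplicativeReductionAt W ℓ` of
`HasseWeilAbelianBadReduction` (*`(V_ℓ E)_{I_𝔓}` is a line on which an arithmetic Frobenius acts
as `-1`*, the Galois side of `L_v(E, T) = 1 + T`, Silverman, *AEC*, C.§16).

The proof is the one printed by Silverman for Thm. IV.10.2(a) (*ATAEC*, PDF p. 359, *"This proof
is taken from Serre–Tate"*), i.e. Serre–Tate's §1 Lemmas 1–2 for elliptic curves, every step of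
which is a theorem of the tree; this file only assembles them:

* **Kodaira–Néron finiteness over `K_v^nr` at the multiplicative places** —
  `WeierstrassCurve.kodairaNeron_exists_finset_reducesToNonsingular_of_hasMultiplicativeReductionAt`
  (`KodairaNeronMultiplicativeProofs`; *ATAEC* Cor. IV.9.2(d), PDF p. 340, over the henselian
  valuation ring of `K_v^nr`, where the node is split and the Tate normal form has index `v(Δ)`);
* **Serre–Tate's Lemma 2 on torsion points for Frobenius elements, from Kodaira–Néron at `v`** —
  `WeierstrassCurve.smul_nsmul_torsion_of_hasMultiplicativeReductionAt_of_kodairaNeron_at`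
  (`HasseWeilAbelianEulerFactorKodairaNeronProofs`: there is `c ≠ 0` with
  `σ(cP) = -(N v • (cP))` for every `I_𝔓`-fixed `P ∈ E(K̄)[ℓⁿ]` in the non-split case — the
  explicit reduction map onto the node `Ẽ_ns(k̄_v) ≅ k̄_vˣ` is anti-equivariant for the
  `N v`-power Frobenius exactly when the tangent slopes are swapped; *AEC* Exercise 3.5(a)(ii),
  VII.2.1, VII.3.1);
* **torsion points ⇒ rational Tate module** —
  `Literature.NumberTheory.EllipticCurves.RationalTateModule.rationalTateRepresentation_eq_neg_smul_of_forall_torsion`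
  (`HasseWeilAbelianEulerFactorTorsion`: clear denominators in `V_ℓ = T_ℓ ⊗ ℚ_ℓ`, compare
  components, cancel `c`);
* **invariants ⇒ coinvariants** — `codim (V_ℓ E)^{I_𝔓} = 1` at the multiplicative places is the
  tree's theorem `codimFixed_inertia_rationalTate_eq_one_of_hasMultiplicativeReductionAt_holds`
  (`InertiaInvariantsMultiplicativeProofs`, *ATAEC* Thm. IV.10.2(a), multiplicative case), and
  `inertiaCoinvariants_rationalTate_of_hasNonsplitMultiplicativeReductionAt_of_codim_of_frobenius`
  (`HasseWeilAbelianEulerFactorElliptic`) does the rest (`det ρ_{E,ℓ}(σ) = N v`).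

Results:

* `WeierstrassCurve.frobenius_smul_fixedSubmodule_inertia_rationalTate_of_hasNonsplitMultiplicativeReductionAt_holds`;
* `WeierstrassCurve.inertiaCoinvariants_rationalTate_of_hasNonsplitMultiplicativeReductionAt_holds`.

What is *not* here: the split multiplicative `V_ℓ`-fact
`smul_fixedSubmodule_inertia_rationalTate_of_hasSplitMultiplicativeReductionAt` (it speaks about
the whole decomposition group `D_𝔓`, not only its Frobenius elements, and is served by
`HasseWeilAbelianEulerFactorFrobenius` along another leaf); the torsion-point facts
`serreTate_frobenius_smul_torsion_of_has(Nons|S)plitMultiplicativeReductionAt` as named theorems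
(the non-split one is used here inline, in the three lines that derive it from the two theorems
above).

## References

* J. H. Silverman, *Advanced Topics in the Arithmetic of Elliptic Curves*, GTM 151 (1994):
  Cor. IV.9.2(d) (PDF p. 340), Thm. IV.10.2(a) and its proof (PDF pp. 358–359), §V.5 Lemma 5.2(c),
  Thm. 5.3 (PDF pp. 406–410), Exercises 5.11(b), 5.13 (PDF p. 416). [SilvermanATAEC1994]
* J.-P. Serre, J. Tate, *Good reduction of abelian varieties*, Ann. of Math. (2) 88 (1968),
  §1 Lemma 1 and Lemma 2 (p. 495). [SerreTate1968]
* J. H. Silverman, *The Arithmetic of Elliptic Curves*, 2nd ed., GTM 106 (2009): Exercise 3.5(a),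
  Prop. VII.2.1, VII.3.1, Thm. VII.6.1, C.§16 (PDF pp. 97, 167–177, 390). [SilvermanAEC2009]

## Design

Theorems only; one universe `u` (`K : Type u`); deliberate dot-notation extensions of Mathlib's
`WeierstrassCurve` namespace, as in the sibling files.  No instances, no `sorry`, no `def`.
-/

noncomputable section

universe u

namespace WeierstrassCurve

open Literature.NumberTheory.EllipticCurves Literature.NumberTheory.GaloisRepresentations
open scoped NumberField
open Field IsDedekindDomain

variable {K : Type u} [Field K] [NumberField K] (W : WeierstrassCurve K) (ℓ : ℕ) [Fact ℓ.Prime]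

/-- **An arithmetic Frobenius acts on `(V_ℓ E)^{I_𝔓}` as `-N v` at a non-split multiplicative
place — discharged.**  For an elliptic curve `E/K` over a number field with non-split
multiplicative reduction at the finite place `v ∤ ℓ`, a prime `𝔓 ∣ v` of `\bar ℤ_K` and an
arithmetic Frobenius `σ ∈ Γ_K` at `𝔓` (Mathlib `IsArithFrobAt`), `σ e = -(N v) e` for every
`e ∈ (V_ℓ E)^{I_𝔓}`: the named fact
`frobenius_smul_fixedSubmodule_inertia_rationalTate_of_hasNonsplitMultiplicativeReductionAt W ℓ`
of `HasseWeilAbelianEulerFactorElliptic` holds.  Printed source: Silverman, *ATAEC*, Thm. V.5.3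
(PDF p. 407: `E ≅ E_q` over `K̄`, over `K` iff split multiplicative reduction) with Lemma V.5.2(c)
(`ψ(P^σ) = χ(σ)ψ(P)^σ`, `χ` the quadratic character of `L = K(√γ(E/K))`, PDF p. 410),
Exercise 5.11(b) (*`E/K` has non-split multiplicative reduction iff `L/K` is unramified of degree
`2`*) and Exercise 5.13(a),(b) (`T_ℓ(E_q)^{I} = T_ℓ(μ)`), PDF p. 416: `V_ℓ(E)^{I} ≅ ℚ_ℓ(χ_ℓ) ⊗ χ`
and `χ_ℓ(σ)χ(σ) = -N v`.  The proof here is the Serre–Tate route printed for *ATAEC*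
Thm. IV.10.2(a) (PDF p. 359): Kodaira–Néron finiteness over `K_v^nr` at the multiplicative place
`v` (`kodairaNeron_exists_finset_reducesToNonsingular_of_hasMultiplicativeReductionAt`, *ATAEC*
Cor. IV.9.2(d)) fed into the tree's rendering of Serre–Tate's Lemmas 1–2 on torsion points
(`smul_nsmul_torsion_of_hasMultiplicativeReductionAt_of_kodairaNeron_at`, non-split branch:
`σ(cP) = -(N v • (cP))` on the `I_𝔓`-fixed `ℓⁿ`-torsion), then torsion points ⇒ `V_ℓ`
(`RationalTateModule.rationalTateRepresentation_eq_neg_smul_of_forall_torsion`).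
[cite: SilvermanATAEC1994, Thm. V.5.3, Lemma V.5.2(c), Exercises 5.11(b) and 5.13(a),(b) (PDF pp. 406–410, 416); proof of Thm. IV.10.2(a) with Cor. IV.9.2(d) (PDF pp. 359, 340)]
[cite: SerreTate1968, §1 Lemma 1 and Lemma 2 (p. 495)] -/
theorem frobenius_smul_fixedSubmodule_inertia_rationalTate_of_hasNonsplitMultiplicativeReductionAt_holds :
    W.frobenius_smul_fixedSubmodule_inertia_rationalTate_of_hasNonsplitMultiplicativeReductionAt
      ℓ := by
  intro _ h v hℓ hv hns 𝔓 h𝔓 σ hσ e he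
  obtain ⟨c, hc, hyp⟩ := W.smul_nsmul_torsion_of_hasMultiplicativeReductionAt_of_kodairaNeron_at ℓ
    (W.kodairaNeron_exists_finset_reducesToNonsingular_of_hasMultiplicativeReductionAt hv) hℓ hv h𝔓
  rw [ContinuousRep.mem_fixedSubmodule] at he
  exact RationalTateModule.rationalTateRepresentation_eq_neg_smul_of_forall_torsion
    (𝔓.inertia (absoluteGaloisGroup K)) σ v.residueCard hc
    (fun n a ha hn ↦ (hyp hσ n a ha hn).2 hns) he

/-- **Non-split multiplicative reduction: `(V_ℓ E)_{I_𝔓}` is a line on which an arithmetic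
Frobenius acts as `-1` — discharged.**  The named fact
`inertiaCoinvariants_rationalTate_of_hasNonsplitMultiplicativeReductionAt W ℓ` of
`HasseWeilAbelianBadReduction` (for an elliptic curve `E/K` over a number field with non-split
multiplicative reduction at `v ∤ ℓ` and `𝔓 ∣ v`: `dim (V_ℓ E)_{I_𝔓} = 1` and every arithmetic
Frobenius at `𝔓` acts on it as `-1`; the Galois side of `L_v(E, T) = 1 + T`, Silverman, *AEC*,
C.§16, PDF p. 390) holds: `codim (V_ℓ E)^{I_𝔓} = 1` at the multiplicative places is the theorem
`codimFixed_inertia_rationalTate_eq_one_of_hasMultiplicativeReductionAt_holds` (*ATAEC*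
Thm. IV.10.2(a), multiplicative case, `InertiaInvariantsMultiplicativeProofs`), the Frobenius
eigenvalue on `(V_ℓ E)^{I_𝔓}` is `-N v`
(`frobenius_smul_fixedSubmodule_inertia_rationalTate_of_hasNonsplitMultiplicativeReductionAt_holds`),
and `det ρ_{E,ℓ}(σ) = N v` gives `-1` on the quotient line
(`inertiaCoinvariants_rationalTate_of_hasNonsplitMultiplicativeReductionAt_of_codim_of_frobenius`).
[cite: SilvermanATAEC1994, Thm. IV.10.2(a), Thm. V.5.3 and Exercises 5.11(b), 5.13 (PDF pp. 358, 407, 416)]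
[cite: SilvermanAEC2009, §C.16 (PDF p. 390)] -/
theorem inertiaCoinvariants_rationalTate_of_hasNonsplitMultiplicativeReductionAt_holds :
    W.inertiaCoinvariants_rationalTate_of_hasNonsplitMultiplicativeReductionAt ℓ :=
  W.inertiaCoinvariants_rationalTate_of_hasNonsplitMultiplicativeReductionAt_of_codim_of_frobenius ℓ
    (W.codimFixed_inertia_rationalTate_eq_one_of_hasMultiplicativeReductionAt_holds ℓ)
    (W.frobenius_smul_fixedSubmodule_inertia_rationalTate_of_hasNonsplitMultiplicativeReductionAt_holds
      ℓ)

end WeierstrassCurve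

end
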